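import Mathlib.AlgebraicGeometry.Morphisms.Smooth
import Mathlib.RingTheory.KrullDimension.Basic
import Literature.AlgebraicGeometry.Motives.AlgPointsProperProofs
import Literature.AlgebraicGeometry.Motives.VarietiesDimensionProofs
import Literature.NumberTheory.Transcendental.Analytification
import HarnessLib

/-!
# The pieces of a smooth `k`-scheme on which it is smooth of a fixed relative dimension

A scheme `E` smooth over a field `k` (Mathlib `AlgebraicGeometry.Smooth`: locally standard smooth,
of SOME relative dimension near each point) need not be equidimensional. This file decomposes it
into the open subschemes `E_N` (`N : ℕ`) covered by the affine opens whose coordinate ring is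
standard smooth of relative dimension `N` over the scalars:

* `Literature.AlgebraicGeometry.Motives.exists_smoothPieces` — there are opens `piece N ⊆ E` with
  (i) `piece N → Spec k` smooth of relative dimension `N` (Mathlib `SmoothOfRelativeDimension`,
  which is defined pointwise by standard smooth affine charts, so this is a repackaging);
  (ii) the `piece N` cover `E`; (iii) a `k`-rational point lies in at most ONE `piece N` — at a
  rational point `P` of a standard smooth affine chart of relative dimension `N` the local ring
  `𝒪_{E,P}` has dimension `N` (it is the localisation of the chart's coordinate ring at the
  rational maximal ideal `𝔪_P`, of height `N`: Görtz–Wedhorn I Lemma 6.26, the tree's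
  `height_eq_of_isStandardSmoothOfRelativeDimension`), and `dim 𝒪_{E,P}` does not depend on the
  chart; (iv) if `E` is quasi-compact, finitely many `N` suffice.

On complex points this is the decomposition of the complex manifold `E(ℂ)` into its open and
closed equidimensional parts (SGA1 XII Prop. 3.1 (iv)/(v): `f` smooth of relative dimension `N`
iff `f^an` is), used to apply Ehresmann's theorem — stated for manifolds of one fixed dimension —
piece by piece (`Motives.Voisin2002_tubeRestrict_isIso`). Everything is proved; no named facts.

## References

* U. Görtz, T. Wedhorn, *Algebraic Geometry I*, 2nd ed. (2020), Lemma 6.26, Thm. 6.28 (relative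
  dimension of smooth morphisms is locally constant). [GortzWedhorn2020]
* A. Grothendieck, M. Raynaud, *SGA 1*, Exp. II Cor. 4.11, Exp. XII Prop. 3.1. [SGA1]
-/

noncomputable section

open CategoryTheory AlgebraicGeometry TopologicalSpace

universe u

namespace Literature.AlgebraicGeometry.Motives

/-! ### Standard smooth ring maps have a relative dimension -/

/-- A standard smooth ring homomorphism is standard smooth of SOME relative dimension (that of
any submersive presentation). [folklore] -/
theorem _root_.RingHom.IsStandardSmooth.exists_isStandardSmoothOfRelativeDimension
    {R S : Type*} [CommRing R] [CommRing S] {f : R →+* S} (hf : f.IsStandardSmooth) :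
    ∃ n, f.IsStandardSmoothOfRelativeDimension n := by
  algebraize [f]
  obtain ⟨ι, σ, _, _, ⟨P⟩⟩ := Algebra.IsStandardSmooth.out (R := R) (S := S)
  exact ⟨P.dimension, ⟨ι, σ, ‹_›, ‹_›, P, rfl⟩⟩

section Pieces

variable {k : Type u} [Field k]

/-! ### The dimension of the local ring at a rational point of a standard smooth affine chart -/

/-- Points of an affine open `U` and basic opens: `y ∈ D(f)` iff `f ∉ 𝔭_y`, `𝔭_y ⊂ Γ(X, U)` the
prime of `y` (Mathlib `IsAffineOpen.primeIdealOf`). [folklore] -/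
theorem mem_basicOpen_iff_notMem_primeIdealOf' {Y : Scheme.{u}} {U : Y.Opens} (hU : IsAffineOpen U)
    (y : U) (f : Γ(Y, U)) : (y : Y) ∈ Y.basicOpen f ↔ f ∉ (hU.primeIdealOf y).asIdeal := by
  have h1 : (y : Y) ∈ Y.basicOpen f ↔ hU.primeIdealOf y ∈ hU.fromSpec ⁻¹ᵁ Y.basicOpen f := by
    change _ ↔ hU.fromSpec.base (hU.primeIdealOf y) ∈ Y.basicOpen f
    rw [hU.fromSpec_primeIdealOf y]
  rw [h1, hU.fromSpec_preimage_basicOpen]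
  exact PrimeSpectrum.mem_basicOpen f (hU.primeIdealOf y)

/-- **At a rational point of a standard smooth affine chart of relative dimension `N`, the local
ring has dimension `N`.** Let `V ⊆ E` be an affine open whose coordinate ring is standard smooth of
relative dimension `N` over the scalars `k → Γ(E, V)` and `P ∈ V(k)` a `k`-rational point. Then
`dim 𝒪_{E,P} = N`: `𝒪_{E,P}` is the localisation of `Γ(E, V)` at the rational maximal ideal
`𝔪_P = ker (evaluation at P)` (Mathlib `IsAffineOpen.isLocalization_stalk`), whose height is `N`
(Görtz–Wedhorn I Lemma 6.26; the tree's `height_eq_of_isStandardSmoothOfRelativeDimension`).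
[cite: GortzWedhorn2020, Lemma 6.26] -/
theorem ringKrullDim_stalk_eq_of_isStandardSmoothOfRelativeDimension {E : SchemeOver k}
    {V : E.left.Opens} (hV : IsAffineOpen V) {N : ℕ}
    (hsm : RingHom.IsStandardSmoothOfRelativeDimension N (SchemeOver.scalarRingHom E V))
    (P : AlgPoints E k) (hPV : P.pt ∈ V) :
    ringKrullDim (E.left.presheaf.stalk P.pt) = N := by
  classical
  letI : Algebra k Γ(E.left, V) := (SchemeOver.scalarRingHom E V).toAlgebra
  haveI : Algebra.IsStandardSmoothOfRelativeDimension N k Γ(E.left, V) := hsm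
  -- the rational maximal ideal of `P`
  set 𝔪 := RingHom.ker (P.evalRingHom V hPV) with h𝔪
  have hsurj : Function.Surjective (P.evalRingHom V hPV) := fun c ↦
    ⟨SchemeOver.scalarRingHom E V c, by
      rw [AlgPoints.evalRingHom_apply, AlgPoints.eval_scalarRingHom]; rfl⟩
  haveI h𝔪max : 𝔪.IsMaximal := RingHom.ker_isMaximal_of_surjective _ hsurj
  have hheight : 𝔪.height = N := height_eq_of_isStandardSmoothOfRelativeDimension k N 𝔪
  -- it is the prime `q` of `P.pt ∈ V`
  set q := (hV.primeIdealOf ⟨P.pt, hPV⟩).asIdeal with hq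
  have hprime : q = 𝔪 := by
    ext a
    rw [h𝔪, RingHom.mem_ker, AlgPoints.evalRingHom_apply, ← not_iff_not,
      ← mem_basicOpen_iff_notMem_primeIdealOf' hV ⟨P.pt, hPV⟩ a]
    exact (AlgPoints.pt_mem_basicOpen_iff P hPV a)
  -- so the stalk is `Γ(E, V)_q`
  letI := TopCat.Presheaf.algebra_section_stalk E.left.presheaf (⟨P.pt, hPV⟩ : V)
  haveI hloc : IsLocalization.AtPrime (E.left.presheaf.stalk P.pt) q :=
    hV.isLocalization_stalk ⟨P.pt, hPV⟩
  have e : Localization.AtPrime q ≃+* E.left.presheaf.stalk P.pt :=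
    (IsLocalization.algEquiv q.primeCompl (Localization.AtPrime q)
      (E.left.presheaf.stalk P.pt)).toRingEquiv
  rw [← ringKrullDim_eq_of_ringEquiv e, IsLocalization.AtPrime.ringKrullDim_eq_height q, hprime,
    hheight]
  rfl

/-! ### The pieces -/

/-- **The equidimensional pieces of a smooth `k`-scheme.** For `E` smooth over the field `k`
there are open subsets `piece N ⊆ E`, `N : ℕ` — the unions of the affine opens with coordinate
ring standard smooth of relative dimension `N` over the scalars — such that:
(i) each open subscheme `piece N` is smooth of relative dimension `N` over `k`;
(ii) the `piece N` cover `E`;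
(iii) a `k`-rational point lies in at most one `piece N` (`dim 𝒪_{E,P}` is both `N` and `N'`,
`ringKrullDim_stalk_eq_of_isStandardSmoothOfRelativeDimension`);
(iv) if `E` is quasi-compact, the points of `E` lie in finitely many `piece N`.
[cite: GortzWedhorn2020, Thm. 6.28 (with Lemma 6.26)] -/
theorem exists_smoothPieces (E : SchemeOver k) [Smooth E.hom] :
    ∃ piece : ℕ → E.left.Opens,
      (∀ N, SmoothOfRelativeDimension N ((piece N).ι ≫ E.hom)) ∧
      (∀ x : E.left, ∃ N, x ∈ piece N) ∧
      (∀ (P : AlgPoints E k) (N N' : ℕ), P.pt ∈ piece N → P.pt ∈ piece N' → N = N') ∧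
      (CompactSpace E.left → ∃ S : Finset ℕ, ∀ x : E.left, ∃ N ∈ S, x ∈ piece N) := by
  classical
  -- the standard smooth affine charts of relative dimension `N`
  let good : ℕ → Set E.left.affineOpens := fun N ↦
    {V | RingHom.IsStandardSmoothOfRelativeDimension N (SchemeOver.scalarRingHom E V)}
  let piece : ℕ → E.left.Opens := fun N ↦ ⨆ V : good N, ((V : E.left.affineOpens) : E.left.Opens)
  have hmem : ∀ {N : ℕ} {x : E.left}, x ∈ piece N ↔ ∃ V ∈ good N, x ∈ (V : E.left.Opens) := by
    intro N x
    simp only [piece, Opens.mem_iSup, Subtype.exists, exists_prop]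
  have hle : ∀ {N : ℕ} {V : E.left.affineOpens}, V ∈ good N → (V : E.left.Opens) ≤ piece N :=
    fun {N V} hV ↦ le_iSup (fun V : good N ↦ ((V : E.left.affineOpens) : E.left.Opens)) ⟨V, hV⟩
  -- scalars versus `E.hom.appLE ⊤ V`
  have hQ : ∀ (N : ℕ) (V : E.left.Opens) (e : V ≤ E.hom ⁻¹ᵁ ⊤),
      RingHom.IsStandardSmoothOfRelativeDimension N (SchemeOver.scalarRingHom E V) ↔
        RingHom.IsStandardSmoothOfRelativeDimension N (E.hom.appLE ⊤ V e).hom := fun N V e ↦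
    RingHom.isStandardSmoothOfRelativeDimension_respectsIso.cancel_left_isIso
      (Scheme.ΓSpecIso (.of k)).inv (E.hom.appLE ⊤ V e)
  refine ⟨piece, fun N ↦ ⟨fun x ↦ ?_⟩, fun x ↦ ?_, fun P N N' hN hN' ↦ ?_, fun hc ↦ ?_⟩
  · -- (i) `piece N` is smooth of relative dimension `N`
    obtain ⟨V, hV, hxV⟩ := hmem.mp (show (piece N).ι.base x ∈ piece N from x.2)
    have hVr : (V : E.left.Opens) ≤ (piece N).ι.opensRange := by
      rw [Scheme.Opens.opensRange_ι]; exact hle hV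
    haveI : IsIso ((piece N).ι.app V) := Scheme.Hom.isIso_app _ _ hVr
    refine ⟨⊤, isAffineOpen_top _, (piece N).ι ⁻¹ᵁ V, V.2.preimage_of_isOpenImmersion _ hVr,
      hxV, le_top, ?_⟩
    have hcomp : ((piece N).ι ≫ E.hom).appLE ⊤ ((piece N).ι ⁻¹ᵁ V) le_top =
        E.hom.appLE ⊤ V le_top ≫ (piece N).ι.app V := by
      rw [Scheme.Hom.app_eq_appLE, Scheme.Hom.appLE_comp_appLE]
    rw [hcomp, CommRingCat.hom_comp,
      RingHom.isStandardSmoothOfRelativeDimension_respectsIso.cancel_right_isIso]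
    exact (hQ N V le_top).mp hV
  · -- (ii) the pieces cover
    obtain ⟨U', -, V, hV, hxV, e, hsm⟩ := Smooth.exists_isStandardSmooth E.hom x
    have hU'top : U' = ⊤ := by
      ext y
      simp only [Opens.coe_top, Set.mem_univ, iff_true, SetLike.mem_coe]
      obtain rfl : y = E.hom.base x := Subsingleton.elim _ _
      exact e hxV
    subst hU'top
    obtain ⟨N, hN⟩ := hsm.exists_isStandardSmoothOfRelativeDimension
    exact ⟨N, hmem.mpr ⟨⟨V, hV⟩, (hQ N V e).mpr hN, hxV⟩⟩
  · -- (iii) rational points lie in one piece only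
    obtain ⟨V, hV, hPV⟩ := hmem.mp hN
    obtain ⟨V', hV', hPV'⟩ := hmem.mp hN'
    have h1 := ringKrullDim_stalk_eq_of_isStandardSmoothOfRelativeDimension V.2 hV P hPV
    have h2 := ringKrullDim_stalk_eq_of_isStandardSmoothOfRelativeDimension V'.2 hV' P hPV'
    rw [h1] at h2
    exact_mod_cast h2
  · -- (iv) finitely many pieces when `E` is quasi-compact
    haveI := hc
    have hcov : ∀ x : E.left, ∃ N, x ∈ piece N := fun x ↦ by
      obtain ⟨U', -, V, hV, hxV, e, hsm⟩ := Smooth.exists_isStandardSmooth E.hom x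
      have hU'top : U' = ⊤ := by
        ext y
        simp only [Opens.coe_top, Set.mem_univ, iff_true, SetLike.mem_coe]
        obtain rfl : y = E.hom.base x := Subsingleton.elim _ _
        exact e hxV
      subst hU'top
      obtain ⟨N, hN⟩ := hsm.exists_isStandardSmoothOfRelativeDimension
      exact ⟨N, hmem.mpr ⟨⟨V, hV⟩, (hQ N V e).mpr hN, hxV⟩⟩
    obtain ⟨t, ht⟩ := isCompact_univ.elim_finite_subcover (fun N : ℕ ↦ (piece N : Set E.left))
      (fun N ↦ (piece N).isOpen) (fun x _ ↦ Set.mem_iUnion.mpr (hcov x))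
    refine ⟨t, fun x ↦ ?_⟩
    have hx := ht (Set.mem_univ x)
    simp only [Set.mem_iUnion] at hx
    obtain ⟨N, hNt, hxN⟩ := hx
    exact ⟨N, hNt, hxN⟩

end Pieces

end Literature.AlgebraicGeometry.Motives

end
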